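import Summits.AtomisticToContinuum.BoseEinsteinCondensation.Theses.BECDistantTilts
import Literature.MathematicalPhysics.QuantumManyBody.OneParticleMarginals

/-!
# Strategist sketch (redirect strategist r1) — crux `TiltCommutation` (stmt-AtomisticToContinuum-12177)

Route `BECDistantTilts` (route-AtomisticToContinuum-BECDistantTilts), sub-problem
`BoseEinsteinCondensation`.  Typed companion of `STRATEGY-CENSUS.md`: every signature quoted in
the census is a declaration of this file (or of `Cruxes/TiltCommutation/Lines/birth.lean`, or a
landed tree theorem).  No `sorry`.

Contents
* §0 abbreviations for the crux data (`IsDirichletGS`, `IsPeriodicGS`, `dens`, `envMarginal`,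
  `cellWeight`, `papangelou`, `tilt`, `symmDiff`, `tiltError`) and the abbreviated crux
  `TiltCommutation'` with `tiltCommutation_iff : TiltCommutation ↔ TiltCommutation'` (by `Iff.rfl`
  up to unfolding: the abbreviations are faithful).
* §1 (reformulation, same strength) `WallWeightFactorisation` — "the wall weight
  `|Φ_D|² / |Θ|²` factorises tag ⊗ environment in `L¹`" — with
  `wallWeightFactorisation_of : TiltCommutation' → WallWeightFactorisation` PROVED (the crux's own
  `ρ_Φ ⊗ π` is such a factorisation); the converse needs a variance bound (census §Strengthen).
* §2 (strengthen S⁺) `UniformCrossRatio` — the Dobrushin-uniform (sup over environments) form of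
  tilt commutation in the bulk; typed only (census explains why the added rigidity is unusable:
  it quantifies over atypical environments and is expected FALSE).
* §3 (transfer / anchor) `JastrowAnchorTilt` — the crux with both ground states replaced by
  finite-range pair-product (Jastrow = classical Gibbs) states; typed only, elementary proof
  sketched in the census (uniform free-volume bound, no decorrelation needed).
* §4 (negation) `not_tiltCommutation'_iff` — the witness shape of `¬ TiltCommutation'`, PROVED by
  `push_neg`.
-/

noncomputable section

open MeasureTheory Filter Set
open scoped ENNReal NNReal Topology

namespace Summit.AtomisticToContinuum.BoseEinsteinCondensation.Cruxes.TiltCommutation.StrategistR1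

open Literature.MathematicalPhysics.QuantumManyBody.BoseGas
open Summit.AtomisticToContinuum.BoseEinsteinCondensation.Theses.BECDistantTilts (TiltCommutation)

/-! ### §0 Abbreviations (verbatim pieces of the crux signature) -/

section Abbrev

variable {n : ℕ}

/-- The crux's Dirichlet ground-state predicate on `Φ : Config (n+1) → ℂ` (verbatim). -/
def IsDirichletGS (v : ℝ → ℝ≥0∞) (n : ℕ) (L : ℝ) (Φ : Config (n + 1) → ℂ) : Prop :=
  Measurable Φ ∧ (∀ X, X ∉ boxN (n + 1) L → Φ X = 0) ∧
    (∫⁻ X, (‖Φ X‖₊ : ℝ≥0∞) ^ 2) = 1 ∧ groundStateEnergy v (n + 1) L ≠ ⊤ ∧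
    ∃ Ψ : ℕ → TrialState (n + 1) L,
      Filter.Tendsto (fun k => energy v (Ψ k)) Filter.atTop (nhds (groundStateEnergy v (n + 1) L)) ∧
      Filter.Tendsto (fun k => ∫⁻ X, (‖(Ψ k).ψ X - Φ X‖₊ : ℝ≥0∞) ^ 2) Filter.atTop (nhds 0)

/-- The crux's periodic ground-state predicate on `Θ : Config (n+1) → ℂ` (verbatim). -/
def IsPeriodicGS (v : ℝ → ℝ≥0∞) (n : ℕ) (L : ℝ) (Θ : Config (n + 1) → ℂ) : Prop :=
  Measurable Θ ∧ (∫⁻ X in cellN (n + 1) L, (‖Θ X‖₊ : ℝ≥0∞) ^ 2) = 1 ∧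
    periodicGroundStateEnergy v (n + 1) L ≠ ⊤ ∧
    ∃ Ψ : ℕ → PeriodicTrialState (n + 1) L,
      Filter.Tendsto (fun k => periodicEnergy v (Ψ k)) Filter.atTop
        (nhds (periodicGroundStateEnergy v (n + 1) L)) ∧
      Filter.Tendsto (fun k => ∫⁻ X in cellN (n + 1) L, (‖(Ψ k).ψ X - Θ X‖₊ : ℝ≥0∞) ^ 2)
        Filter.atTop (nhds 0)

/-- One-particle density `ρ_Φ(x) = N ∫ |Φ(x,Y)|² dY` (`N = n+1`). -/
def dens (Φ : Config (n + 1) → ℂ) : Space → ℝ≥0∞ :=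
  fun x => ((n : ℝ≥0∞) + 1) * ∫⁻ Y : Config n, (‖Φ (Matrix.vecCons x Y)‖₊ : ℝ≥0∞) ^ 2

/-- Environment (`(N-1)`-particle) marginal `m_Φ(Y) = ∫ |Φ(z,Y)|² dz`. -/
def envMarginal (Φ : Config (n + 1) → ℂ) : Config n → ℝ≥0∞ :=
  fun Y => ∫⁻ z : Space, (‖Φ (Matrix.vecCons z Y)‖₊ : ℝ≥0∞) ^ 2

/-- Torus weight `|Θ|² 1_{cell^N}`. -/
def cellWeight (L : ℝ) (Θ : Config (n + 1) → ℂ) : Config (n + 1) → ℝ≥0∞ :=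
  (cellN (n + 1) L).indicator fun X => (‖Θ X‖₊ : ℝ≥0∞) ^ 2

/-- Periodic insertion (Papangelou) weight `λ(x;Y) = |Θ(x,Y)|² 1_cell / ∫ |Θ(z,Y)|² 1_cell dz`. -/
def papangelou (L : ℝ) (Θ : Config (n + 1) → ℂ) : Space → Config n → ℝ≥0∞ :=
  fun x Y => cellWeight L Θ (Matrix.vecCons x Y) / ∫⁻ z : Space, cellWeight L Θ (Matrix.vecCons z Y)

/-- The tilt `π_x(Y) = λ(x;Y) m_Φ(Y) / ∫ λ(x;W) m_Φ(W) dW` of the wall-tilted marginal by the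
periodic insertion weight. -/
def tilt (L : ℝ) (Φ Θ : Config (n + 1) → ℂ) : Space → Config n → ℝ≥0∞ :=
  fun x Y => papangelou L Θ x Y * envMarginal Φ Y /
    ∫⁻ W : Config n, papangelou L Θ x W * envMarginal Φ W

/-- Symmetrised truncated difference `(a - b) + (b - a) = |a - b|` in `ℝ≥0∞`. -/
def symmDiff (a b : ℝ≥0∞) : ℝ≥0∞ := (a - b) + (b - a)

/-- The C1 error functional: density-weighted total variation between the Palm law of `|Φ|²` and
the tilt, `∫dx ∫dY |N|Φ(x,Y)|² − ρ_Φ(x) π_x(Y)|`. -/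
def tiltError (L : ℝ) (Φ Θ : Config (n + 1) → ℂ) : ℝ≥0∞ :=
  ∫⁻ x : Space, ∫⁻ Y : Config n,
    symmDiff (((n : ℝ≥0∞) + 1) * (‖Φ (Matrix.vecCons x Y)‖₊ : ℝ≥0∞) ^ 2) (dens Φ x * tilt L Φ Θ x Y)

end Abbrev

/-- The crux in abbreviated form. -/
def TiltCommutation' : Prop :=
  ∀ v : ℝ → ℝ≥0∞, IsRepulsiveFiniteRange v → ∃ ρ₀ : ℝ, 0 < ρ₀ ∧ ∀ ρ : ℝ, 0 < ρ → ρ < ρ₀ →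
    ∀ η : ℝ, 0 < η → ∀ᶠ n : ℕ in Filter.atTop, ∀ L : ℝ, L = sideLength ρ (n + 1) →
    ∀ Φ : Config (n + 1) → ℂ, IsDirichletGS v n L Φ → ∀ Θ : Config (n + 1) → ℂ, IsPeriodicGS v n L Θ →
      tiltError L Φ Θ ≤ ENNReal.ofReal η * ((n : ℝ≥0∞) + 1)

/-- **Faithfulness of the abbreviations.** The route decl `TiltCommutation` (which spells the
data as `∀ ρΦ, ρΦ = … → ∀ mΦ, mΦ = … → ∀ lam, lam = … → ∀ π, π = … → …`) is equivalent to the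
abbreviated form. -/
theorem tiltCommutation_iff : TiltCommutation ↔ TiltCommutation' := by
  constructor
  · intro h v hv
    obtain ⟨ρ₀, hρ₀, H⟩ := h v hv
    refine ⟨ρ₀, hρ₀, fun ρ hρ hρlt η hη => ?_⟩
    filter_upwards [H ρ hρ hρlt η hη] with n hn
    intro L hL Φ hΦ Θ hΘ
    exact hn L hL Φ hΦ Θ hΘ (dens Φ) rfl (envMarginal Φ) rfl (papangelou L Θ) rfl (tilt L Φ Θ) rfl
  · intro h v hv
    obtain ⟨ρ₀, hρ₀, H⟩ := h v hv
    refine ⟨ρ₀, hρ₀, fun ρ hρ hρlt η hη => ?_⟩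
    filter_upwards [H ρ hρ hρlt η hη] with n hn
    intro L hL Φ hΦ Θ hΘ ρΦ hρΦ mΦ hmΦ lam hlam π hπ
    subst hρΦ hmΦ hlam hπ
    exact hn L hL Φ hΦ Θ hΘ

/-! ### §1 Reformulation of the same strength: the wall weight factorises -/

/-- **Wall-weight factorisation** (`|Φ_D|² ≈ f ⊗ g · |Θ|² 1_cell` in `L¹`): for every
tolerance, eventually, for every Dirichlet ground state `Φ` and periodic ground state `Θ` there
are a one-body factor `f` and an environment factor `g` with
`∫dx ∫dY |N|Φ(x,Y)|² − f(x) g(Y) |Θ(x,Y)|² 1_cell| ≤ η N`.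
"Wall tilt and tag tilt commute" in its cleanest form: the Radon–Nikodym derivative of the
Dirichlet ground-state measure w.r.t. the torus one has no tag×environment cross term in `L¹`. -/
def WallWeightFactorisation : Prop :=
  ∀ v : ℝ → ℝ≥0∞, IsRepulsiveFiniteRange v → ∃ ρ₀ : ℝ, 0 < ρ₀ ∧ ∀ ρ : ℝ, 0 < ρ → ρ < ρ₀ →
    ∀ η : ℝ, 0 < η → ∀ᶠ n : ℕ in Filter.atTop, ∀ L : ℝ, L = sideLength ρ (n + 1) →
    ∀ Φ : Config (n + 1) → ℂ, IsDirichletGS v n L Φ → ∀ Θ : Config (n + 1) → ℂ, IsPeriodicGS v n L Θ →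
      ∃ f : Space → ℝ≥0∞, ∃ g : Config n → ℝ≥0∞,
        ∫⁻ x : Space, ∫⁻ Y : Config n,
          symmDiff (((n : ℝ≥0∞) + 1) * (‖Φ (Matrix.vecCons x Y)‖₊ : ℝ≥0∞) ^ 2)
            (f x * g Y * cellWeight L Θ (Matrix.vecCons x Y)) ≤ ENNReal.ofReal η * ((n : ℝ≥0∞) + 1)

/-- The crux's `ρ_Φ(x) π_x(Y)` IS a product `f(x) g(Y) |Θ(x,Y)|² 1_cell` with
`f = ρ_Φ / Z`, `g = m_Φ / ∫|Θ(z,·)|² 1_cell dz` (pure commutativity of `*` and `⁻¹` in `ℝ≥0∞`). -/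
theorem dens_mul_tilt_eq {n : ℕ} (L : ℝ) (Φ Θ : Config (n + 1) → ℂ) (x : Space) (Y : Config n) :
    dens Φ x * tilt L Φ Θ x Y =
      (dens Φ x / ∫⁻ W : Config n, papangelou L Θ x W * envMarginal Φ W) *
        (envMarginal Φ Y / ∫⁻ z : Space, cellWeight L Θ (Matrix.vecCons z Y)) *
        cellWeight L Θ (Matrix.vecCons x Y) := by
  simp only [tilt, papangelou, div_eq_mul_inv]
  ring

/-- `TiltCommutation' → WallWeightFactorisation` (exact witnesses `f = ρ_Φ/Z`, `g = m_Φ/D`). -/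
theorem wallWeightFactorisation_of (h : TiltCommutation') : WallWeightFactorisation := by
  intro v hv
  obtain ⟨ρ₀, hρ₀, H⟩ := h v hv
  refine ⟨ρ₀, hρ₀, fun ρ hρ hρlt η hη => ?_⟩
  filter_upwards [H ρ hρ hρlt η hη] with n hn
  intro L hL Φ hΦ Θ hΘ
  refine ⟨fun x => dens Φ x / ∫⁻ W : Config n, papangelou L Θ x W * envMarginal Φ W,
    fun Y => envMarginal Φ Y / ∫⁻ z : Space, cellWeight L Θ (Matrix.vecCons z Y), ?_⟩
  have key := hn L hL Φ hΦ Θ hΘ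
  simp only [tiltError, dens_mul_tilt_eq] at key
  exact key

/-! ### §2 Strengthening S⁺: the Dobrushin-uniform cross-ratio form -/

/-- **Uniform cross-ratio bound** (S⁺, sup over environments): for every `ε` there is a wall
distance `d` such that, eventually, at a.e. bulk point `x` and for (Lebesgue-)a.e. PAIR of
environments `Y, Y'`, the cross ratio of the Dirichlet and periodic conditional intensities is
`≤ 1 + ε` — written denominator-free:
`|Φ(x,Y)|² · |Θ(x,Y')|²1 · m_Φ(Y') · D(Y) ≤ (1+ε) · |Θ(x,Y)|²1 · |Φ(x,Y')|² · m_Φ(Y) · D(Y')`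
with `D(Y) = ∫ |Θ(z,Y)|² 1 dz`.  This is the Dobrushin-type UNIFORM influence bound; it implies
the bulk a.e. tilt commutation (`Birth.BulkPalmTilt`) pointwise, but it quantifies over atypical
environments (chains of particles bridging `x` to a wall) and is expected to be false as typed —
the census records why the added rigidity is unusable. -/
def UniformCrossRatio : Prop :=
  ∀ v : ℝ → ℝ≥0∞, IsRepulsiveFiniteRange v → ∃ ρ₀ : ℝ, 0 < ρ₀ ∧ ∀ ρ : ℝ, 0 < ρ → ρ < ρ₀ →
    ∀ ε : ℝ, 0 < ε → ∃ d : ℝ, 0 < d ∧ ∀ᶠ n : ℕ in Filter.atTop, ∀ L : ℝ, L = sideLength ρ (n + 1) →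
    ∀ Φ : Config (n + 1) → ℂ, IsDirichletGS v n L Φ → ∀ Θ : Config (n + 1) → ℂ, IsPeriodicGS v n L Θ →
    ∀ᵐ x : Space, (∀ k, d ≤ x k ∧ x k ≤ L - d) →
      ∀ᵐ Y : Config n, ∀ᵐ Y' : Config n,
        (‖Φ (Matrix.vecCons x Y)‖₊ : ℝ≥0∞) ^ 2 * cellWeight L Θ (Matrix.vecCons x Y') *
            envMarginal Φ Y' * ∫⁻ z : Space, cellWeight L Θ (Matrix.vecCons z Y) ≤
          ENNReal.ofReal (1 + ε) * (cellWeight L Θ (Matrix.vecCons x Y) *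
            (‖Φ (Matrix.vecCons x Y')‖₊ : ℝ≥0∞) ^ 2 * envMarginal Φ Y *
            ∫⁻ z : Space, cellWeight L Θ (Matrix.vecCons z Y'))

/-! ### §3 Transfer anchor: pair-product (Jastrow = classical Gibbs) states -/

section Jastrow

variable {n : ℕ}

/-- Pair-product (Jastrow) weight with a one-body profile `φ` and a pair factor `f`:
`J(X) = ∏ᵢ φ(xᵢ) · ∏_{i<j} f(|xᵢ - xⱼ|)`. -/
def jastrow (N : ℕ) (φ : Space → ℝ≥0) (f : ℝ → ℝ≥0) (X : Config N) : ℝ≥0 :=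
  (∏ i : Fin N, φ (X i)) * ∏ i : Fin N, ∏ j ∈ Finset.univ.filter (fun j => i < j), f (dist (X i) (X j))

/-- Nearest-image periodised pair factor `f_per(x) = ∏_{m ∈ {-1,0,1}³} f(|x - L m|)` (for a factor
with `f = 1` beyond a range `R₀ < L` only the 27 nearest images can differ from `1`). -/
def periodizedFactor (L : ℝ) (f : ℝ → ℝ≥0) (x : Space) : ℝ≥0 :=
  ∏ m : Fin 3 → Fin 3, f ‖x - latticeVec L (fun k => ((m k : ℕ) : ℤ) - 1)‖

/-- Torus Jastrow weight `∏_{i<j} f_per(xᵢ - xⱼ)` (no one-body factor: translation invariant). -/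
def jastrowTorus (N : ℕ) (L : ℝ) (f : ℝ → ℝ≥0) (X : Config N) : ℝ≥0 :=
  ∏ i : Fin N, ∏ j ∈ Finset.univ.filter (fun j => i < j), periodizedFactor L f (X i - X j)

/-- **Jastrow anchor of the crux** (transfer sibling = classical finite-range Gibbs measure, GNZ
locality).  Data: a pair factor `f ≤ 1` with `f = 1` beyond the range `R₀` (repulsive, finite
range), a one-body profile `φ ≤ 1` supported in the box and `= 1` at distance `> b` from the
walls, at range-dilution `36 π (N/L³) R₀³ ≤ 1/2`.  Conclusion: the C1 error of the pair
(`Φ_J = 1_box^N · J / ‖·‖`, `Θ_J = jastrowTorus / ‖·‖_cell`) is at most the density mass of the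
layer of width `max R₀ b` plus `48 (b + R₀)/L · N` — with NO ground-state hypotheses and no
probabilistic input: in the bulk `λ_D(x;Y) = φ(x)² λ_P(x;Y) · D_P(Y)/D_D(Y)` exactly, and the
free-volume ratio `D_P/D_D ∈ [1, 1 + 12(b+R₀)/L · 2]` uniformly in `Y` because `f, φ ≤ 1` and
`D_P(Y) ≥ L³/2` at range-dilution ≤ 1/2.  (Elementary; a few hundred lines of Tonelli/`Finset.prod`
bookkeeping; not landed.)  It is the provable first rung of the method family and exhibits the
exact structural input the quantum crux lacks: a finite-range, boundary-condition-free
conditional intensity. -/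
def JastrowAnchorTilt : Prop :=
  ∀ (n : ℕ) (L R₀ b : ℝ) (φ : Space → ℝ≥0) (f : ℝ → ℝ≥0),
    0 < R₀ → 0 < b → b + R₀ < L / 4 →
    Measurable φ → Measurable f → (∀ r, f r ≤ 1) → (∀ r, R₀ < r → f r = 1) →
    (∀ x, φ x ≤ 1) → (∀ x, x ∉ box L → φ x = 0) → (∀ x : Space, (∀ k, b ≤ x k ∧ x k ≤ L - b) → φ x = 1) →
    36 * Real.pi * (((n : ℝ) + 1) / L ^ 3) * R₀ ^ 3 ≤ 1 / 2 →
    ∀ Φ Θ : Config (n + 1) → ℂ,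
      Φ = (fun X => ((jastrow (n + 1) φ f X : ℝ) : ℂ) /
        (((∫⁻ Z, ((jastrow (n + 1) φ f Z : ℝ≥0∞)) ^ 2) ^ ((1 : ℝ) / 2)).toReal : ℂ)) →
      Θ = (fun X => ((jastrowTorus (n + 1) L f X : ℝ) : ℂ) /
        (((∫⁻ Z in cellN (n + 1) L, ((jastrowTorus (n + 1) L f Z : ℝ≥0∞)) ^ 2) ^ ((1 : ℝ) / 2)).toReal : ℂ)) →
      tiltError L Φ Θ ≤
        2 * (∫⁻ x in {x : Space | ∀ k, max R₀ b ≤ x k ∧ x k ≤ L - max R₀ b}ᶜ, dens Φ x) +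
          ENNReal.ofReal (48 * (b + R₀) / L) * ((n : ℝ≥0∞) + 1)

end Jastrow

/-! ### §4 Negation: the witness shape -/

/-- **Witness shape of `¬ C1`.** A counterexample is an admissible `v` such that for arbitrarily
small densities there is a tolerance `η > 0` and infinitely many `N` with a Dirichlet ground state
`Φ` and a periodic ground state `Θ` whose density-weighted Palm-vs-tilt total variation exceeds
`η N` — only EXACT ground states (limits of minimising sequences) are admissible witnesses. -/
theorem not_tiltCommutation'_iff :
    ¬ TiltCommutation' ↔
      ∃ v : ℝ → ℝ≥0∞, IsRepulsiveFiniteRange v ∧ ∀ ρ₀ : ℝ, 0 < ρ₀ → ∃ ρ : ℝ, 0 < ρ ∧ ρ < ρ₀ ∧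
        ∃ η : ℝ, 0 < η ∧ ∃ᶠ n : ℕ in Filter.atTop, ∃ L : ℝ, L = sideLength ρ (n + 1) ∧
        ∃ Φ : Config (n + 1) → ℂ, IsDirichletGS v n L Φ ∧ ∃ Θ : Config (n + 1) → ℂ, IsPeriodicGS v n L Θ ∧
          ENNReal.ofReal η * ((n : ℝ≥0∞) + 1) < tiltError L Φ Θ := by
  simp only [TiltCommutation', not_forall, not_exists, not_and, Filter.not_eventually, not_le,
    exists_prop]

/-- Pointer: the crux by name follows from the abbreviated form (so any line may target either). -/
theorem tiltCommutation_of' (h : TiltCommutation') : TiltCommutation := tiltCommutation_iff.mpr h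

end Summit.AtomisticToContinuum.BoseEinsteinCondensation.Cruxes.TiltCommutation.StrategistR1
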